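import Summits.Ventures.YMGap.RobustBall.BoundaryFreeEnergyVanHove
import Summits.Ventures.YMGap.RobustBall.BoundaryRelativeEntropy
import Summits.Ventures.YMGap.RobustBall.WilsonOneStateSymmetry
import HarnessLib

/-!
# Venture YMGap, track ROBUST-BALL — «C-TDL»: THE THERMODYNAMIC LIMIT OF THE FREE ENERGY, THE MEAN ENERGY AND THE ENTROPY PER PLAQUETTE
# ALONG ARBITRARY VAN HOVE SEQUENCES WITH ARBITRARY BOUNDARY FIELDS, `SU(2)` on `ℤ⁴`, EVERY `0 ≤ β_W ≤ 9/25`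

HONEST FRAMING. WHAT THIS IS: a venture file (cell `pub-ymgap`, track Y2 ROBUST-BALL / DS, seat ds-3, theorems only, 0 compute): the LIMIT form of
«C-DS-I» for ARBITRARY SHAPES. A VAN HOVE SEQUENCE WITH DEPTH DATA is a sequence of finite link volumes `Λ_n` (with `T(Λ_n) ≠ ∅`), `1`-Lipschitz depth
functions `φ_n` of `Λ_n` (`φ_n > 0 ⇒ ∈ Λ_n`), depths `m_{n,p} ≤ φ_n` on the links of the plaquettes touching `Λ_n`, such that for EVERY depth budget `K`
the fraction of shallow plaquettes `#{p ∈ T(Λ_n) : m_{n,p} < 4K}/#T(Λ_n)` tends to `0` (cubes of side `→ ∞` with `φ = M + 1 − ‖x‖_∞` qualify; so does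
any sequence with surface/volume `→ 0`). `SU(2)`, `d = 4`, tree coupling `0 ≤ b ≤ 9/50` (Wilson `0 ≤ β_W ≤ 9/25`), `f = freeEnergyDensity 4 ρ₂`, `μ` THE
DLR state at `b` (unique, translation invariant and axis symmetric on the window), `u(b) = μ(Re tr U_{p₀})` its mean plaquette:
* ★★★ `su2_log_normaliser_div_vanHove_uniform` — FREE ENERGY: `∀ ε > 0, ∃ n₀, ∀ n ≥ n₀, ∀ η, |log Z_{Λ_n}(b|η)/#T(Λ_n) − f(b)/6| ≤ ε` — the
  finite-volume free energy per plaquette converges to the infinite-volume free energy per plaquette along EVERY van Hove sequence, UNIFORMLY IN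
  THE BOUNDARY FIELD (hence for every sequence of boundary fields `η_n`: `su2_log_normaliser_div_vanHove_tendsto`);
* ★★★ `su2_kernel_energy_div_vanHove_uniform` — MEAN ENERGY: `γ_{Λ_n}^b(S_{Λ_n}|η)/#T(Λ_n) → 2 − u(b)` uniformly in `η` (+ `_tendsto`);
* ★★★ `su2_klDiv_div_vanHove_uniform` — ENTROPY: `KL(π_{Λ_n}^{b,η} ‖ Haar_{Λ_n})/#T(Λ_n) → −b(2 − u(b)) − f(b)/6` uniformly in `η` (+ `_tendsto`) — the
  specific relative entropy (w.r.t. Haar) of the inner Gibbs law exists in the thermodynamic limit and does not depend on the boundary conditions.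
All three from the quantitative van Hove forms of «C-DS-I» (`BoundaryFreeEnergyVanHove`) and the entropy identity (`BoundaryRelativeEntropy`): rate
`b·(1024√2·e^{−κ₁(R_G(2b))K} + 4·(shallow fraction at budget K))` for every `K`.
WHAT THIS IS NOT: lattice strong coupling (the window is the vertex-star window `β_W ≤ 9/25`); existence of `f` itself is the tree's torus free energy
(`freeEnergyDensity`), not re-proved here; nothing about the continuum limit or Clay. Everything here is proved. [folklore]
References: Dobrushin–Shlosman, J. Stat. Phys. 46 (1987), Condition I (statement shape); Georgii 2011, §15.3 (van Hove limits).
-/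

noncomputable section

open MeasureTheory ProbabilityTheory InformationTheory Filter Topology Real Finset Set
open scoped NNReal
open Literature.Probability.LatticeModels hiding configShift configShift_apply
open Literature.MathematicalPhysics.QuantumLattice
open Literature.MathematicalPhysics.QuantumFieldTheory (haarProbability)
open Summit.Ventures.YMGap.StarWindowGauge (gaugeR gaugeR_lt_one_of_le)
open Summit.Ventures.YMGap.StarLemmaG (gaugeR_nonneg)

namespace Summit.Ventures.YMGap.RobustBall

namespace BoundaryFreeEnergy

/-- **Choosing the depth budget and the index**: if `0 < κ` and the shallow fractions `s_n(K)` tend to `0` for every budget `K`, then for every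
`ε > 0` there are `K` and `n₀` with `a·(C·e^{−κK} + 4·s_n(K)) ≤ ε` for all `n ≥ n₀`. [folklore] -/
theorem exists_budget_of_vanHove {κ : ℝ} (hκ : 0 < κ) (a C : ℝ) (s : ℕ → ℕ → ℝ)
    (hs : ∀ K : ℕ, Tendsto (fun n => s n K) atTop (𝓝 0)) {ε : ℝ} (hε : 0 < ε) :
    ∃ K n₀ : ℕ, ∀ n ≥ n₀, a * (C * Real.exp (-(κ * K)) + 4 * s n K) ≤ ε := by
  -- the deep part: `a C e^{−κK} → 0`
  have h1 : Tendsto (fun K : ℕ => a * C * Real.exp (-(κ * K))) atTop (𝓝 0) := by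
    have h : Tendsto (fun K : ℕ => Real.exp (-(κ * K))) atTop (𝓝 0) :=
      Real.tendsto_exp_neg_atTop_nhds_zero.comp (Tendsto.const_mul_atTop hκ tendsto_natCast_atTop_atTop)
    simpa using h.const_mul (a * C)
  obtain ⟨K, hK⟩ := (h1.eventually (eventually_le_nhds (show (0 : ℝ) < ε / 2 by linarith))).exists
  -- the shallow part at that budget: `4 a s_n(K) → 0`
  have h2 : Tendsto (fun n => a * (4 * s n K)) atTop (𝓝 0) := by simpa using ((hs K).const_mul 4).const_mul a
  obtain ⟨n₀, hn₀⟩ := eventually_atTop.1 (h2.eventually (eventually_le_nhds (show (0 : ℝ) < ε / 2 by linarith)))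
  refine ⟨K, n₀, fun n hn => ?_⟩
  have := hn₀ n hn
  nlinarith [hK, this]

section SU2

variable {b : ℝ} (hb0 : 0 ≤ b) (hb : b ≤ 9 / 50) (Λ : ℕ → Finset (ZdEdge 4)) (hT : ∀ n, (plaquettesTouching (Λ n)).Nonempty)
  (φ : ℕ → ZdEdge 4 → ℝ) (hφ : ∀ n (x y : ZdEdge 4), φ n x ≤ φ n y + ‖x.1 - y.1‖) (hφΛ : ∀ n x, 0 < φ n x → x ∈ Λ n)
  (m : ℕ → ZdPlaquette 4 → ℝ) (hm : ∀ n, ∀ p ∈ plaquettesTouching (Λ n), ∀ x ∈ plaquetteEdges p, m n p ≤ φ n x)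
  (hvH : ∀ K : ℕ, Tendsto (fun n => ((((plaquettesTouching (Λ n)).filter fun p => m n p < 4 * K).card : ℝ)) /
    (plaquettesTouching (Λ n)).card) atTop (𝓝 0))
include hb0 hb hT hφ hφΛ hm hvH

/-- ★★★ **THE FREE ENERGY PER PLAQUETTE CONVERGES ALONG EVERY VAN HOVE SEQUENCE, UNIFORMLY IN THE BOUNDARY FIELD** (`SU(2)`, `d = 4`, tree
coupling `0 ≤ b ≤ 9/50`): `∀ ε > 0, ∃ n₀, ∀ n ≥ n₀, ∀ η, |log Z_{Λ_n}(b|η)/#T(Λ_n) − f(b)/6| ≤ ε`. [folklore] -/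
theorem su2_log_normaliser_div_vanHove_uniform :
    ∀ ε > 0, ∃ n₀ : ℕ, ∀ n ≥ n₀, ∀ η : LGConfig 4 (SUN 2),
      |Real.log (∫ ζ, Real.exp (-b * wilsonBoundaryAction (fundamentalRep (Fin 2)) (Λ n) (glueWith (Λ n) ζ η))
            ∂(Measure.pi fun _ : ↥(Λ n) => haarProbability (SUN 2))) / (plaquettesTouching (Λ n)).card -
          freeEnergyDensity 4 (fundamentalRep (Fin 2)) b / 6| ≤ ε := by
  intro ε hε
  have hκ : 0 < starRate 4 (gaugeR (2 * b)) :=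
    starRate_pos (gaugeR_nonneg (by linarith) (by linarith)) (gaugeR_lt_one_of_le (by linarith) (by linarith))
  obtain ⟨K, n₀, hKn⟩ := exists_budget_of_vanHove hκ b (1024 * Real.sqrt 2)
    (fun n K => ((((plaquettesTouching (Λ n)).filter fun p => m n p < 4 * K).card : ℝ)) / (plaquettesTouching (Λ n)).card) hvH hε
  refine ⟨n₀, fun n hn η => ?_⟩
  have h' := hKn n hn
  rw [← mul_div_assoc] at h'
  exact (su2_abs_log_normaliser_div_sub_le_of_depth hb0 hb (Λ n) (hT n) η (φ n) (hφ n) (hφΛ n) (m n) (hm n) K).trans h'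

/-- ★★ **… hence for EVERY sequence of boundary fields `η_n`**: `log Z_{Λ_n}(b|η_n)/#T(Λ_n) → f(b)/6`. [folklore] -/
theorem su2_log_normaliser_div_vanHove_tendsto (η : ℕ → LGConfig 4 (SUN 2)) :
    Tendsto (fun n => Real.log (∫ ζ, Real.exp (-b * wilsonBoundaryAction (fundamentalRep (Fin 2)) (Λ n) (glueWith (Λ n) ζ (η n)))
        ∂(Measure.pi fun _ : ↥(Λ n) => haarProbability (SUN 2))) / (plaquettesTouching (Λ n)).card)
      atTop (𝓝 (freeEnergyDensity 4 (fundamentalRep (Fin 2)) b / 6)) := by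
  rw [Metric.tendsto_atTop]
  intro ε hε
  obtain ⟨n₀, hn₀⟩ := su2_log_normaliser_div_vanHove_uniform hb0 hb Λ hT φ hφ hφΛ m hm hvH (ε / 2) (by linarith)
  refine ⟨n₀, fun n hn => ?_⟩
  rw [Real.dist_eq]
  linarith [hn₀ n hn (η n)]

/-- ★★★ **THE MEAN ENERGY PER PLAQUETTE CONVERGES ALONG EVERY VAN HOVE SEQUENCE, UNIFORMLY IN THE BOUNDARY FIELD**, to the infinite-volume
mean plaquette energy `2 − u(b)` of THE DLR state `μ` (`u(b) = μ(Re tr U_{p₀})`, all plaquette means being equal):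
`∀ ε > 0, ∃ n₀, ∀ n ≥ n₀, ∀ η, |γ_{Λ_n}^b(S_{Λ_n}|η)/#T(Λ_n) − (2 − u(b))| ≤ ε`. [folklore] -/
theorem su2_kernel_energy_div_vanHove_uniform {μ : Measure (LGConfig 4 (SUN 2))}
    (hμ : μ ∈ ymGibbsMeasures (d := 4) (fundamentalRep (Fin 2)) b) :
    ∀ ε > 0, ∃ n₀ : ℕ, ∀ n ≥ n₀, ∀ η : LGConfig 4 (SUN 2),
      |(∫ U, wilsonBoundaryAction (fundamentalRep (Fin 2)) (Λ n) U ∂(ymSpecification (d := 4) (fundamentalRep (Fin 2)) b (Λ n) η)) /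
            (plaquettesTouching (Λ n)).card -
          ((2 : ℝ) - ∫ U, plaquetteObs (fundamentalRep (Fin 2)) 0 0 1 U ∂μ)| ≤ ε := by
  intro ε hε
  have hρc : Continuous (fundamentalRep (Fin 2)) := continuous_fundamentalRep (Fin 2)
  have hκ : 0 < starRate 4 (gaugeR (2 * b)) :=
    starRate_pos (gaugeR_nonneg (by linarith) (by linarith)) (gaugeR_lt_one_of_le (by linarith) (by linarith))
  obtain ⟨K, n₀, hKn⟩ := exists_budget_of_vanHove hκ 1 (1024 * Real.sqrt 2)
    (fun n K => ((((plaquettesTouching (Λ n)).filter fun p => m n p < 4 * K).card : ℝ)) / (plaquettesTouching (Λ n)).card) hvH hε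
  -- the one state is axis symmetric: all plaquette means agree
  obtain ⟨ν, h1, h2, -, -⟩ := su2_wilson_oneState_symmetric (b := b) (abs_le.2 ⟨by linarith, hb⟩)
  have hμν : μ = ν := by rw [h1] at hμ; exact Set.mem_singleton_iff.1 hμ
  have hνL : ν ∈ infiniteVolumeLimitPoints (d := 4) (fundamentalRep (Fin 2)) b := by rw [h2]; exact Set.mem_singleton _
  refine ⟨n₀, fun n hn η => ?_⟩
  have hTpos : (0 : ℝ) < ((plaquettesTouching (Λ n)).card : ℝ) := by exact_mod_cast Finset.card_pos.2 (hT n)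
  have hplane : ∀ p ∈ plaquettesTouching (Λ n), ∫ U, plaquetteObs (fundamentalRep (Fin 2)) p.1 p.2.1.1 p.2.1.2 U ∂μ =
      ∫ U, plaquetteObs (fundamentalRep (Fin 2)) 0 0 1 U ∂μ := fun p _ => by
    rw [hμν]; exact PlaquettePositivity.integral_plaquetteObs_eq (fundamentalRep (Fin 2)) hρc (by norm_num) hνL p.1 (ne_of_lt p.2.2)
  have hsum : (∑ p ∈ plaquettesTouching (Λ n), ((2 : ℝ) - ∫ U, plaquetteObs (fundamentalRep (Fin 2)) p.1 p.2.1.1 p.2.1.2 U ∂μ)) /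
      (plaquettesTouching (Λ n)).card = (2 : ℝ) - ∫ U, plaquetteObs (fundamentalRep (Fin 2)) 0 0 1 U ∂μ := by
    rw [Finset.sum_congr rfl fun p hp => by rw [hplane p hp], Finset.sum_const, nsmul_eq_mul, mul_div_cancel_left₀ _ hTpos.ne']
  have h := su2_abs_kernel_energy_div_sub_le_of_depth hb0 hb hμ (Λ n) (hT n) η (φ n) (hφ n) (hφΛ n) (m n) (hm n) K
  rw [hsum] at h
  have h' := hKn n hn
  rw [one_mul, ← mul_div_assoc] at h'
  exact h.trans h'

/-- ★★ **… hence for EVERY sequence of boundary fields `η_n`**: `γ_{Λ_n}^b(S_{Λ_n}|η_n)/#T(Λ_n) → 2 − u(b)`. [folklore] -/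
theorem su2_kernel_energy_div_vanHove_tendsto {μ : Measure (LGConfig 4 (SUN 2))}
    (hμ : μ ∈ ymGibbsMeasures (d := 4) (fundamentalRep (Fin 2)) b) (η : ℕ → LGConfig 4 (SUN 2)) :
    Tendsto (fun n => (∫ U, wilsonBoundaryAction (fundamentalRep (Fin 2)) (Λ n) U
        ∂(ymSpecification (d := 4) (fundamentalRep (Fin 2)) b (Λ n) (η n))) / (plaquettesTouching (Λ n)).card)
      atTop (𝓝 ((2 : ℝ) - ∫ U, plaquetteObs (fundamentalRep (Fin 2)) 0 0 1 U ∂μ)) := by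
  rw [Metric.tendsto_atTop]
  intro ε hε
  obtain ⟨n₀, hn₀⟩ := su2_kernel_energy_div_vanHove_uniform hb0 hb Λ hT φ hφ hφΛ m hm hvH hμ (ε / 2) (by linarith)
  refine ⟨n₀, fun n hn => ?_⟩
  rw [Real.dist_eq]
  linarith [hn₀ n hn (η n)]

/-- ★★★ **THE ENTROPY PER PLAQUETTE CONVERGES ALONG EVERY VAN HOVE SEQUENCE, UNIFORMLY IN THE BOUNDARY FIELD**: the relative entropy of the
inner Gibbs law `π_{Λ_n}^{b,η}` with respect to the product Haar law, per plaquette, tends to `−b(2 − u(b)) − f(b)/6`: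
`∀ ε > 0, ∃ n₀, ∀ n ≥ n₀, ∀ η, |KL(π_{Λ_n}^{b,η} ‖ Haar_{Λ_n})/#T(Λ_n) − (−b(2 − u(b)) − f(b)/6)| ≤ ε`. [folklore] -/
theorem su2_klDiv_div_vanHove_uniform {μ : Measure (LGConfig 4 (SUN 2))}
    (hμ : μ ∈ ymGibbsMeasures (d := 4) (fundamentalRep (Fin 2)) b) :
    ∀ ε > 0, ∃ n₀ : ℕ, ∀ n ≥ n₀, ∀ η : LGConfig 4 (SUN 2),
      |(klDiv ((Measure.pi fun _ : ↥(Λ n) => haarProbability (SUN 2)).tilted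
            (fun ζ => -b * wilsonBoundaryAction (fundamentalRep (Fin 2)) (Λ n) (glueWith (Λ n) ζ η)))
          (Measure.pi fun _ : ↥(Λ n) => haarProbability (SUN 2))).toReal / (plaquettesTouching (Λ n)).card -
          (-b * ((2 : ℝ) - ∫ U, plaquetteObs (fundamentalRep (Fin 2)) 0 0 1 U ∂μ) - freeEnergyDensity 4 (fundamentalRep (Fin 2)) b / 6)| ≤ ε := by
  intro ε hε
  have hρc : Continuous (fundamentalRep (Fin 2)) := continuous_fundamentalRep (Fin 2)
  have hb1 : (0 : ℝ) < b + 1 := by linarith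
  obtain ⟨n₁, hn₁⟩ := su2_log_normaliser_div_vanHove_uniform hb0 hb Λ hT φ hφ hφΛ m hm hvH (ε / 2) (by linarith)
  obtain ⟨n₂, hn₂⟩ := su2_kernel_energy_div_vanHove_uniform hb0 hb Λ hT φ hφ hφΛ m hm hvH hμ (ε / (2 * (b + 1))) (by positivity)
  refine ⟨max n₁ n₂, fun n hn η => ?_⟩
  have hTpos : (0 : ℝ) < ((plaquettesTouching (Λ n)).card : ℝ) := by exact_mod_cast Finset.card_pos.2 (hT n)
  have e1 := hn₁ n (le_of_max_le_left hn) η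
  have e2 := hn₂ n (le_of_max_le_right hn) η
  rw [toReal_klDiv_inner_law_haar_eq (fundamentalRep (Fin 2)) hρc b (Λ n) η]
  set LZ := Real.log (∫ ζ, Real.exp (-b * wilsonBoundaryAction (fundamentalRep (Fin 2)) (Λ n) (glueWith (Λ n) ζ η))
    ∂(Measure.pi fun _ : ↥(Λ n) => haarProbability (SUN 2))) with hLZ
  set E := ∫ U, wilsonBoundaryAction (fundamentalRep (Fin 2)) (Λ n) U ∂(ymSpecification (d := 4) (fundamentalRep (Fin 2)) b (Λ n) η) with hE
  set T : ℝ := ((plaquettesTouching (Λ n)).card : ℝ) with hTdef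
  set u := ∫ U, plaquetteObs (fundamentalRep (Fin 2)) 0 0 1 U ∂μ with hu
  set f := freeEnergyDensity 4 (fundamentalRep (Fin 2)) b with hf
  have eq : (-b * E - LZ) / T - (-b * (2 - u) - f / 6) = -b * (E / T - (2 - u)) - (LZ / T - f / 6) := by
    field_simp
    ring
  rw [eq]
  have hbE : |b * (E / T - (2 - u))| ≤ b * (ε / (2 * (b + 1))) := by
    rw [abs_mul, abs_of_nonneg hb0]; exact mul_le_mul_of_nonneg_left e2 hb0
  have hb2 : b * (ε / (2 * (b + 1))) ≤ ε / 2 := by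
    rw [mul_div_assoc', div_le_div_iff₀ (by positivity) (by norm_num)]
    nlinarith
  calc |-b * (E / T - (2 - u)) - (LZ / T - f / 6)|
      ≤ |-b * (E / T - (2 - u))| + |LZ / T - f / 6| := abs_sub _ _
    _ ≤ ε / 2 + ε / 2 := by rw [neg_mul, abs_neg]; exact add_le_add (hbE.trans hb2) e1
    _ = ε := by ring

/-- ★★ **… hence for EVERY sequence of boundary fields `η_n`**: `KL(π_{Λ_n}^{b,η_n} ‖ Haar_{Λ_n})/#T(Λ_n) → −b(2 − u(b)) − f(b)/6` — the
specific relative entropy of the inner Gibbs law exists in the thermodynamic limit and does not depend on the boundary conditions. [folklore] -/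
theorem su2_klDiv_div_vanHove_tendsto {μ : Measure (LGConfig 4 (SUN 2))}
    (hμ : μ ∈ ymGibbsMeasures (d := 4) (fundamentalRep (Fin 2)) b) (η : ℕ → LGConfig 4 (SUN 2)) :
    Tendsto (fun n => (klDiv ((Measure.pi fun _ : ↥(Λ n) => haarProbability (SUN 2)).tilted
          (fun ζ => -b * wilsonBoundaryAction (fundamentalRep (Fin 2)) (Λ n) (glueWith (Λ n) ζ (η n))))
        (Measure.pi fun _ : ↥(Λ n) => haarProbability (SUN 2))).toReal / (plaquettesTouching (Λ n)).card)
      atTop (𝓝 (-b * ((2 : ℝ) - ∫ U, plaquetteObs (fundamentalRep (Fin 2)) 0 0 1 U ∂μ) - freeEnergyDensity 4 (fundamentalRep (Fin 2)) b / 6)) := by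
  rw [Metric.tendsto_atTop]
  intro ε hε
  obtain ⟨n₀, hn₀⟩ := su2_klDiv_div_vanHove_uniform hb0 hb Λ hT φ hφ hφΛ m hm hvH hμ (ε / 2) (by linarith)
  refine ⟨n₀, fun n hn => ?_⟩
  rw [Real.dist_eq]
  linarith [hn₀ n hn (η n)]

end SU2

end BoundaryFreeEnergy

end Summit.Ventures.YMGap.RobustBall

end
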